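import Summits.Ventures.HodgeRepro2.T7SupportFockTraceDecomposition

/-!
# The traceless hyperplane is THE unique stable complement of the scalars (support, seat p1)

Row 719 (`T7SupportFockTraceDecomposition`) decomposes the bidegree-(1,1) Fock space `ofMatrix (M₃(ℂ))` as
`ℂ · 1 ⊕ {tr = 0}` and shows the decomposition «invariant + trace-zero» is unique. That the traceless hyperplane is THE
non-trivial isotypic part — i.e. the only `matAct`-stable complement of the scalar line — was left in words (complete
reducibility of the compact group `U(3)`; t7-crit-1 record R17). This file removes the words with a FINITE averaging,
no Haar measure: for `w` in a stable subspace `W` with `W ∩ ℂ·1 = 0`,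

* `T w = w + Σ_{m : Fin 3} matAct (signDiag m) w` (`signDiag m` = the diagonal matrix with `−1` at `m`, unitary) is
  `4 · diag(w)` (`T_apply`);
* `S A = A + matAct shift A + matAct shift (matAct shift A)` (`shift` = the cyclic permutation matrix, unitary) turns a
  diagonal matrix into `(its trace) • 1`; altogether `S (T w) = (4 · tr w) • 1` (`S_T_eq`), which lies in `W ∩ ℂ·1 = 0`,
  so `tr w = 0` (`trace_eq_zero_of_mem`).

Consequences: `eq_traceless_of_isCompl` (a stable complement of the scalars IS the traceless hyperplane),
`unique_stable_complement`, `isStable_traceless` / `isCompl_scalars_traceless` (row 719's decomposition as an `IsCompl`),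
and `eq_tracePart_of_proj`: a linear map fixing the scalars, with range in the scalars and a stable kernel, IS
`tracePart` — the unique equivariant projection onto the invariants with stable kernel. Finite-dimensional linear
algebra over `Matrix (Fin 3) (Fin 3) ℂ` only; nothing about any period, (N) or (P). Blind lane: Mathlib + the HodgeRepro2
prefix only; no sorry; axioms ⊆ {propext, Classical.choice, Quot.sound}.
-/

namespace Summit.Ventures.HodgeRepro2.T7SupportFockStableComplement

open Matrix
open T7SupportFockBidegreeOneOne T7SupportFockTraceDecomposition

/-- The scalar line `ℂ · 1` in `M₃(ℂ)`. -/
def scalars : Submodule ℂ (Matrix (Fin 3) (Fin 3) ℂ) := ℂ ∙ (1 : Matrix (Fin 3) (Fin 3) ℂ)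

/-- The traceless hyperplane `{tr = 0}` in `M₃(ℂ)`. -/
def traceless : Submodule ℂ (Matrix (Fin 3) (Fin 3) ℂ) := LinearMap.ker (Matrix.traceLinearMap (Fin 3) ℂ ℂ)

/-- A subspace of `M₃(ℂ)` is stable if every unitary `u` carries it into itself under `matAct`. -/
def IsStable (W : Submodule ℂ (Matrix (Fin 3) (Fin 3) ℂ)) : Prop :=
  ∀ u : Matrix (Fin 3) (Fin 3) ℂ, u * uᴴ = 1 → ∀ A ∈ W, matAct u A ∈ W

/-- Membership in the traceless hyperplane. -/
theorem mem_traceless {A : Matrix (Fin 3) (Fin 3) ℂ} : A ∈ traceless ↔ A.trace = 0 := by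
  simp [traceless, LinearMap.mem_ker]

/-- Membership in the scalar line. -/
theorem mem_scalars {A : Matrix (Fin 3) (Fin 3) ℂ} : A ∈ scalars ↔ ∃ c : ℂ, c • (1 : Matrix (Fin 3) (Fin 3) ℂ) = A :=
  Submodule.mem_span_singleton

/-- The traceless hyperplane is stable (row 718's `trace_matAct`). -/
theorem isStable_traceless : IsStable traceless := by
  intro u hu A hA
  rw [mem_traceless] at hA ⊢
  rw [trace_matAct hu, hA]

/-- The scalar line and the traceless hyperplane are complementary (row 719's decomposition). -/
theorem isCompl_scalars_traceless : IsCompl scalars traceless := by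
  rw [isCompl_iff]
  constructor
  · rw [Submodule.disjoint_def]
    intro x hx hx'
    obtain ⟨c, rfl⟩ := mem_scalars.mp hx
    rw [mem_traceless, Matrix.trace_smul, Matrix.trace_one, Fintype.card_fin, smul_eq_mul] at hx'
    have h3 : (↑(3 : ℕ) : ℂ) ≠ 0 := by norm_num
    rw [(mul_eq_zero.mp hx').resolve_right h3, zero_smul]
  · rw [Submodule.codisjoint_iff_exists_add_eq]
    intro A
    exact ⟨tracePart A, tracelessPart A, mem_scalars.mpr ⟨_, rfl⟩, mem_traceless.mpr (trace_tracelessPart A),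
      tracePart_add_tracelessPart A⟩

/-! ### The finite averaging: sign matrices and the cyclic shift -/

/-- The sign vector with `−1` at `m` and `1` elsewhere. -/
def sgn (m j : Fin 3) : ℂ := if j = m then -1 else 1

/-- The diagonal sign matrix with `−1` at `m`. -/
def signDiag (m : Fin 3) : Matrix (Fin 3) (Fin 3) ℂ := diagonal (sgn m)

/-- The sign vector is real: `star (sgn m j) = sgn m j`. -/
theorem star_sgn (m j : Fin 3) : star (sgn m j) = sgn m j := by
  unfold sgn
  split_ifs <;> simp

/-- The sign vector squares to `1`. -/
theorem sgn_mul_self (m j : Fin 3) : sgn m j * sgn m j = 1 := by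
  unfold sgn
  split_ifs <;> norm_num

/-- The sign matrices are unitary. -/
theorem signDiag_unitary (m : Fin 3) : signDiag m * (signDiag m)ᴴ = 1 := by
  rw [signDiag, diagonal_conjTranspose, diagonal_mul_diagonal, ← diagonal_one]
  congr 1
  funext j
  rw [Pi.star_apply, star_sgn, sgn_mul_self]

/-- `matAct` by a sign matrix multiplies the `(j, l)` entry by `sgn m j * sgn m l`. -/
theorem matAct_signDiag_apply (m : Fin 3) (A : Matrix (Fin 3) (Fin 3) ℂ) (j l : Fin 3) :
    matAct (signDiag m) A j l = sgn m j * A j l * sgn m l := by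
  have hmap : (signDiag m).map star = signDiag m := by
    rw [signDiag, diagonal_map (star_zero ℂ)]
    congr 1
    funext j
    rw [star_sgn]
  rw [matAct, hmap, signDiag, diagonal_transpose, mul_diagonal, diagonal_mul]

/-- The sign average: `A + Σ_m matAct (signDiag m) A`. -/
noncomputable def T (A : Matrix (Fin 3) (Fin 3) ℂ) : Matrix (Fin 3) (Fin 3) ℂ := A + ∑ m, matAct (signDiag m) A

/-- The sign sums: `1 + Σ_m sgn m j * sgn m l = 4 · [j = l]`. -/
theorem one_add_sum_sgn (j l : Fin 3) : 1 + ∑ m, sgn m j * sgn m l = if j = l then 4 else 0 := by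
  fin_cases j <;> fin_cases l <;> simp [sgn, Fin.sum_univ_three] <;> norm_num

/-- The sign average is `4 · diag(A)`. -/
theorem T_apply (A : Matrix (Fin 3) (Fin 3) ℂ) (j l : Fin 3) : T A j l = if j = l then 4 * A j l else 0 := by
  have h : T A j l = A j l * (1 + ∑ m, sgn m j * sgn m l) := by
    simp only [T, Matrix.add_apply, Matrix.sum_apply, matAct_signDiag_apply, mul_add, mul_one, Finset.mul_sum]
    congr 1
    refine Finset.sum_congr rfl fun m _ => ?_
    ring
  rw [h, one_add_sum_sgn]
  split_ifs <;> ring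

/-- The cyclic shift matrix: `shift j l = [l = j + 1]`. -/
def shift : Matrix (Fin 3) (Fin 3) ℂ := of fun j l => if l = j + 1 then 1 else 0

/-- The shift matrix has real entries. -/
theorem shift_map_star : shift.map star = shift := by
  ext j l
  simp only [shift, Matrix.map_apply, of_apply]
  split_ifs <;> simp

/-- `(shift * M) j l = M (j + 1) l`. -/
theorem shift_mul_apply (M : Matrix (Fin 3) (Fin 3) ℂ) (j l : Fin 3) : (shift * M) j l = M (j + 1) l := by
  simp [mul_apply, shift, ite_mul, Finset.sum_ite_eq']

/-- `(M * shiftᵀ) j l = M j (l + 1)`. -/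
theorem mul_shift_transpose_apply (M : Matrix (Fin 3) (Fin 3) ℂ) (j l : Fin 3) :
    (M * shiftᵀ) j l = M j (l + 1) := by
  simp [mul_apply, shift, transpose_apply, mul_ite, Finset.sum_ite_eq']

/-- The shift matrix has real entries: `shiftᴴ = shiftᵀ`. -/
theorem shift_conjTranspose : shiftᴴ = shiftᵀ := by
  ext j l
  simp only [conjTranspose_apply, transpose_apply, shift, of_apply]
  split_ifs <;> simp

/-- The shift matrix is unitary. -/
theorem shift_unitary : shift * shiftᴴ = 1 := by
  rw [shift_conjTranspose]
  ext j k
  rw [mul_shift_transpose_apply, Matrix.one_apply]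
  simp only [shift, of_apply]
  fin_cases j <;> fin_cases k <;> simp

/-- `matAct` by the shift moves every index by one: `matAct shift A j l = A (j + 1) (l + 1)`. -/
theorem matAct_shift_apply (A : Matrix (Fin 3) (Fin 3) ℂ) (j l : Fin 3) :
    matAct shift A j l = A (j + 1) (l + 1) := by
  rw [matAct, shift_map_star, mul_shift_transpose_apply, shift_mul_apply]

/-- The shift average: `A + matAct shift A + matAct shift (matAct shift A)`. -/
noncomputable def S (A : Matrix (Fin 3) (Fin 3) ℂ) : Matrix (Fin 3) (Fin 3) ℂ :=
  A + matAct shift A + matAct shift (matAct shift A)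

/-- The shift average, entrywise. -/
theorem S_apply (A : Matrix (Fin 3) (Fin 3) ℂ) (j l : Fin 3) :
    S A j l = A j l + A (j + 1) (l + 1) + A (j + 1 + 1) (l + 1 + 1) := by
  simp only [S, Matrix.add_apply, matAct_shift_apply]

/-- **The composite average is `(4 · tr A) • 1`.** -/
theorem S_T_eq (A : Matrix (Fin 3) (Fin 3) ℂ) : S (T A) = (4 * A.trace) • (1 : Matrix (Fin 3) (Fin 3) ℂ) := by
  ext j l
  rw [S_apply, T_apply, T_apply, T_apply, Matrix.smul_apply, Matrix.one_apply, Matrix.trace, Fin.sum_univ_three]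
  simp only [Matrix.diag_apply, smul_eq_mul]
  fin_cases j <;> fin_cases l <;> simp <;> ring

/-! ### The uniqueness of the stable complement -/

/-- The sign average stays in a stable subspace. -/
theorem T_mem {W : Submodule ℂ (Matrix (Fin 3) (Fin 3) ℂ)} (hW : IsStable W) {A : Matrix (Fin 3) (Fin 3) ℂ}
    (hA : A ∈ W) : T A ∈ W :=
  W.add_mem hA (W.sum_mem fun m _ => hW _ (signDiag_unitary m) A hA)

/-- The shift average stays in a stable subspace. -/
theorem S_mem {W : Submodule ℂ (Matrix (Fin 3) (Fin 3) ℂ)} (hW : IsStable W) {A : Matrix (Fin 3) (Fin 3) ℂ}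
    (hA : A ∈ W) : S A ∈ W :=
  W.add_mem (W.add_mem hA (hW _ shift_unitary A hA)) (hW _ shift_unitary _ (hW _ shift_unitary A hA))

/-- **A stable subspace meeting the scalars trivially consists of traceless matrices.** -/
theorem trace_eq_zero_of_mem {W : Submodule ℂ (Matrix (Fin 3) (Fin 3) ℂ)} (hW : IsStable W)
    (hdisj : Disjoint scalars W) {A : Matrix (Fin 3) (Fin 3) ℂ} (hA : A ∈ W) : A.trace = 0 := by
  have h1 : S (T A) ∈ W := S_mem hW (T_mem hW hA)
  rw [S_T_eq] at h1
  have h2 : (4 * A.trace) • (1 : Matrix (Fin 3) (Fin 3) ℂ) ∈ scalars := mem_scalars.mpr ⟨_, rfl⟩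
  have h3 := Submodule.disjoint_def.mp hdisj _ h2 h1
  rcases smul_eq_zero.mp h3 with h3 | h3
  · have h4 : (4 : ℂ) ≠ 0 := by norm_num
    exact (mul_eq_zero.mp h3).resolve_left h4
  · exact absurd h3 one_ne_zero

/-- **A stable complement of the scalars IS the traceless hyperplane.** -/
theorem eq_traceless_of_isCompl {W : Submodule ℂ (Matrix (Fin 3) (Fin 3) ℂ)} (hW : IsStable W)
    (h : IsCompl scalars W) : W = traceless := by
  ext A
  constructor
  · intro hA
    exact mem_traceless.mpr (trace_eq_zero_of_mem hW h.disjoint hA)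
  · intro hA
    rw [mem_traceless] at hA
    obtain ⟨x, y, hx, hy, hxy⟩ := Submodule.codisjoint_iff_exists_add_eq.mp h.codisjoint A
    obtain ⟨c, rfl⟩ := mem_scalars.mp hx
    have hy0 : y.trace = 0 := trace_eq_zero_of_mem hW h.disjoint hy
    have htr : A.trace = c * 3 := by
      rw [← hxy, Matrix.trace_add, hy0, add_zero, Matrix.trace_smul, Matrix.trace_one, Fintype.card_fin, smul_eq_mul]
      push_cast
      ring
    have hc : c = 0 := by
      rw [hA] at htr
      have h3 : (3 : ℂ) ≠ 0 := by norm_num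
      exact (mul_eq_zero.mp htr.symm).resolve_right h3
    rw [hc, zero_smul, zero_add] at hxy
    rw [← hxy]
    exact hy

/-- **Uniqueness of the stable complement** of the scalar line. -/
theorem unique_stable_complement {W W' : Submodule ℂ (Matrix (Fin 3) (Fin 3) ℂ)} (hW : IsStable W)
    (hW' : IsStable W') (h : IsCompl scalars W) (h' : IsCompl scalars W') : W = W' :=
  (eq_traceless_of_isCompl hW h).trans (eq_traceless_of_isCompl hW' h').symm

/-- Uniqueness of the decomposition «scalar + trace-zero» (row 719's `decomposition_unique` with the scalar given). -/
theorem decomposition_unique_of_smul_one {A C' : Matrix (Fin 3) (Fin 3) ℂ} {c : ℂ}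
    (hABC : A = c • (1 : Matrix (Fin 3) (Fin 3) ℂ) + C') (hC : C'.trace = 0) :
    c • (1 : Matrix (Fin 3) (Fin 3) ℂ) = tracePart A ∧ C' = tracelessPart A := by
  have htr : A.trace = c * 3 := by
    rw [hABC, Matrix.trace_add, hC, add_zero, Matrix.trace_smul, Matrix.trace_one, Fintype.card_fin, smul_eq_mul]
    push_cast
    ring
  have hB : c • (1 : Matrix (Fin 3) (Fin 3) ℂ) = tracePart A := by
    rw [tracePart, htr]
    congr 1
    field_simp
  refine ⟨hB, ?_⟩
  rw [tracelessPart, ← hB, hABC, add_sub_cancel_left]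

/-- **The unique equivariant projection**: a linear map fixing the scalars, with range in the scalars and a stable
kernel, is `tracePart`. -/
theorem eq_tracePart_of_proj (P : Matrix (Fin 3) (Fin 3) ℂ →ₗ[ℂ] Matrix (Fin 3) (Fin 3) ℂ)
    (hP1 : ∀ c : ℂ, P (c • (1 : Matrix (Fin 3) (Fin 3) ℂ)) = c • (1 : Matrix (Fin 3) (Fin 3) ℂ))
    (hPr : ∀ A, ∃ c : ℂ, P A = c • (1 : Matrix (Fin 3) (Fin 3) ℂ)) (hker : IsStable (LinearMap.ker P))
    (A : Matrix (Fin 3) (Fin 3) ℂ) : P A = tracePart A := by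
  have hc : IsCompl scalars (LinearMap.ker P) := by
    rw [isCompl_iff]
    constructor
    · rw [Submodule.disjoint_def]
      intro x hx hx'
      obtain ⟨c, rfl⟩ := mem_scalars.mp hx
      rw [LinearMap.mem_ker, hP1] at hx'
      exact hx'
    · rw [Submodule.codisjoint_iff_exists_add_eq]
      intro z
      obtain ⟨c, hcz⟩ := hPr z
      refine ⟨P z, z - P z, ?_, ?_, add_sub_cancel _ _⟩
      · rw [hcz]
        exact mem_scalars.mpr ⟨c, rfl⟩
      · rw [LinearMap.mem_ker, map_sub, hcz, hP1, sub_self]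
  have hk := eq_traceless_of_isCompl hker hc
  obtain ⟨c, hcA⟩ := hPr A
  have hmem : A - P A ∈ LinearMap.ker P := by
    rw [LinearMap.mem_ker, map_sub, hcA, hP1, sub_self]
  rw [hk, mem_traceless] at hmem
  have hdec := decomposition_unique_of_smul_one (A := A) (c := c) (C' := A - P A) (by rw [← hcA]; abel) hmem
  rw [hcA]
  exact hdec.1

/-- The kernel of an equivariant linear map is stable (t7-crit-1 record R19 (ii)). -/
theorem isStable_ker_of_equivariant (P : Matrix (Fin 3) (Fin 3) ℂ →ₗ[ℂ] Matrix (Fin 3) (Fin 3) ℂ)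
    (hequiv : ∀ u : Matrix (Fin 3) (Fin 3) ℂ, u * uᴴ = 1 → ∀ A, P (matAct u A) = matAct u (P A)) :
    IsStable (LinearMap.ker P) := by
  intro u hu A hA
  rw [LinearMap.mem_ker] at hA ⊢
  rw [hequiv u hu, hA, matAct, Matrix.mul_zero, Matrix.zero_mul]

/-- **The unique equivariant projection, representation-theoretic form**: a `matAct`-equivariant linear map fixing the
scalars with range in the scalars is `tracePart` — «trace component» = «trivial-isotypic component». -/
theorem eq_tracePart_of_equivariant_proj (P : Matrix (Fin 3) (Fin 3) ℂ →ₗ[ℂ] Matrix (Fin 3) (Fin 3) ℂ)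
    (hP1 : ∀ c : ℂ, P (c • (1 : Matrix (Fin 3) (Fin 3) ℂ)) = c • (1 : Matrix (Fin 3) (Fin 3) ℂ))
    (hPr : ∀ A, ∃ c : ℂ, P A = c • (1 : Matrix (Fin 3) (Fin 3) ℂ))
    (hequiv : ∀ u : Matrix (Fin 3) (Fin 3) ℂ, u * uᴴ = 1 → ∀ A, P (matAct u A) = matAct u (P A))
    (A : Matrix (Fin 3) (Fin 3) ℂ) : P A = tracePart A :=
  eq_tracePart_of_proj P hP1 hPr (isStable_ker_of_equivariant P hequiv) A

end Summit.Ventures.HodgeRepro2.T7SupportFockStableComplement
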